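import Mathlib
import Summits.ResolutionOfSingularities.ResolutionOfSingularities.Theorems.WildQuotientsWildQuotientResolutionJordanFourI6Abstract
import Summits.ResolutionOfSingularities.ResolutionOfSingularities.Theorems.WildQuotientsWildQuotientResolutionJordanFourTwistEngine
import HarnessLib

/-!
# Programme V4U, package T2 (b): the twisted root chart ring `Γ(W_T) = B_T[1/θ] ≅ E_Q` of `Bl_{I₆} 𝔸ⁿ` at the `μ₂`-vertex

(crux stmt-ResolutionOfSingularities-15640 `WildQuotients.WildQuotientResolution`, line `Sketch`,
sector `|G| = p`; programme V4U of `L/w45c/CHAIN.md` v6 §4 row stub-2, design of record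
`L/w45c/V4U-DESIGN.md` §3/§6 T2 (b); [OURS · L1 W4.5c] — NOT a statement of any manuscript; replaces the
role of no printed item.)

`B_T = (k[x][I₆t])_{(T't)}` is the Rees chart ring of `Bl_{I₆} 𝔸ⁿ` at `T' = x_b³ − 3x_ax_bx_c + 3x_a²x_d − x_a²x_b`
(`∈ I₆`), `θ = (H'³t²)/(T't)² ∈ B_T` (`H' = x_b² − x_ax_b − 2x_ax_c`, `H'³ ∈ I₆²`), and
`W_T = D₊(T't) ∩ D(θ) = D₊(T'H'³t³)` is the `σ`-stable affine piece of the `μ₂`-vertex; `Γ(W_T)` is a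
localisation of `B_T` at `θ`. **`exists_chartT_ringEquiv`**: for every twist datum `ψ` with the values of
V4U-DESIGN §3 (T-iii: `ψx_a = s³A`, `ψH' = s⁴Q`, `ψT' = s⁶Q`, `ψM = ξs³Q`; T-iv: `ψg_j = s⁶q_j`, `q_j` even;
all `ψxᵢ` even; passengers fixed — stub-1's `twistedChart` is the instance of record) and every
localisation `C` of `B_T` at `θ`: `C ≃+* E_Q = k[s², sA, sξ, A², Aξ, ξ², η, passengers][1/Q]`, carrying
`F/1 ↦ ψF`, `(g_jt)/(T't) ↦ q_j/Q`, `θ ↦ Q`. Stated for an ABSTRACT generator vector `g : Fin 8 → k[x]` with `g j =` the monomials of record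
(instantiate with the vector of record and `rfl`; see `…JordanFourI6Abstract` for why). Proof = the twist
engine (`…JordanFourTwistEngine`) + the memberships of `…JordanFourI6Abstract` (inverse dictionary `s² ↤ (H'²/T')θ⁻¹`, `sA ↤ x_aH'/T'`,
`sξ ↤ (MH'/T')θ⁻¹`, `A² ↤ (x_a²/T')θ`, `Aξ ↤ x_aM/T'`, `ξ² ↤ (M²/T')θ⁻¹`, `η ↤ (Δ₇/T'²)θ⁻¹`).
Equivariance / uniqueness of such identifications: `JordanFour.ringHom_ext_of_reesChart`
(`…ReesChartTheta`).
-/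

-- single-problem summit: the doubled namespace component `ResolutionOfSingularities` is forced
set_option linter.dupNamespace false

noncomputable section

open MvPolynomial IsLocalization Polynomial HomogeneousLocalization Literature.AlgebraicGeometry.Resolution

namespace Summit.ResolutionOfSingularities.ResolutionOfSingularities.Theorems.WildQuotientResolution.JordanFour

section ChartT

/-! ### §(b') The instance of record: `B_T[1/θ] ≅ E_Q` for `I₆`, `T'`, `θ = (H'³t²)/(T't)²` -/

variable (k : Type) [Field k] (n : ℕ) (a b c d : Fin n) (g : Fin 8 → MvPolynomial (Fin n) k)
  (hg0 : g 0 = X a ^ 2) (hg1 : g 1 = X a * X b ^ 2) (hg2 : g 2 = X a * X b * X c) (hg3 : g 3 = X a * X c ^ 3)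
  (hg4 : g 4 = X b ^ 3) (hg5 : g 5 = X b ^ 2 * X c ^ 2) (hg6 : g 6 = X b * X c ^ 4) (hg7 : g 7 = X c ^ 6)

local notation3 "I6" => Ideal.span (Set.range g)
local notation3 "Tp" => (X b ^ 3 - 3 * X a * X b * X c + 3 * X a ^ 2 * X d - X a ^ 2 * X b :
  MvPolynomial (Fin n) k)
local notation3 "Hp" => (X b ^ 2 - X a * X b - 2 * X a * X c : MvPolynomial (Fin n) k)
local notation3 "Mp" => (X b * X c - X b ^ 2 + X a * X b - 3 * X a * X d : MvPolynomial (Fin n) k)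
local notation3 "Qp" => (1 - 3 * X b * X a + X a ^ 2 * X d : MvPolynomial (Fin n) k)
local notation3 "hT" => Tprime_mem_span k n a b c d g hg0 hg1 hg2 hg3 hg4 hg5 hg6 hg7
local notation3 "hH3" => Hcube_mem_span_sq k n a b c g hg0 hg1 hg2 hg3 hg4 hg5 hg6
local notation3 "BT" => HomogeneousLocalization.Away (reesGrading I6) (reesT Tp hT)
local notation3 "φT" => reesChartBase (I := I6) Tp hT
local notation3 (prettyPrint := false) "θT" =>
  HomogeneousLocalization.Away.mk (reesGrading I6) (reesT_mem Tp hT) 2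
    (⟨monomial 2 (Hp ^ 3), reesAlgebra.monomial_mem.mpr hH3⟩ : reesAlgebra I6)
    (monomial_two_mem_reesGrading k n g (Hp ^ 3) hH3)
local notation3 "Egens" => (({X b ^ 2, X b * X a, X b * X c, X a ^ 2, X a * X c, X c ^ 2} :
    Set (MvPolynomial (Fin n) k)) ∪ (fun i : Fin n => (X i : MvPolynomial (Fin n) k)) '' {i | i ≠ a ∧ i ≠ b ∧ i ≠ c})
local notation3 "LQ" => Localization.Away Qp
local notation3 "EQ" => Algebra.adjoin k ((algebraMap (MvPolynomial (Fin n) k) LQ) '' Egens ∪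
    {(IsLocalization.Away.invSelf Qp : LQ)})

-- unifying the engine's conclusion with the concrete `I₆` data is one large but routine check
include hg0 hg1 hg2 hg3 hg4 hg5 hg6 hg7 in
set_option maxHeartbeats 800000 in
/-- **T2(b): the twisted root chart ring `Γ(W_T) = B_T[1/θ] ≅ E_Q` of `Bl_{I₆} 𝔸ⁿ`** (V4U-DESIGN §3;
`B_T = (k[x][I₆t])_{(T't)}`, `θ = (H'³t²)/(T't)²`, `W_T = D₊(T't) ∩ D(θ)`; `C` is any localisation of
`B_T` at `θ`, e.g. `Γ(Bl_{I₆} 𝔸ⁿ, W_T)`). The twist datum `ψ` (stub-1's `twistedChart` is the instance of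
record) is an injective `k`-algebra endomorphism of `k[x]` with `ψ x_a = s³A`, `ψ H' = s⁴Q`, `ψ T' = s⁶Q`,
`ψ M = ξs³Q` (V4U-DESIGN T-iii), `ψ g_j = s⁶ q_j` (T-iv) with the `q_j` and all `ψ xᵢ` even
(`∈ E = k[s², sA, sξ, A², Aξ, ξ², (xᵢ)_{i ∉ {a,b,c}}]`) and the passengers fixed; then
`C ≃+* E_Q = E[1/Q]`, `F/1 ↦ ψF`, `(g_jt)/(T't) ↦ q_j/Q`, `θ ↦ Q` — by the twist engine with the inverse
dictionary `s² ↤ (H'²/T')θ⁻¹`, `sA ↤ x_aH'/T'`, `sξ ↤ (MH'/T')θ⁻¹`, `A² ↤ (x_a²/T')θ`, `Aξ ↤ x_aM/T'`,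
`ξ² ↤ (M²/T')θ⁻¹`, `η ↤ (Δ₇/T'²)θ⁻¹` (§(a)). [OURS · L1 W4.5c] [folklore] -/
theorem exists_chartT_ringEquiv (had : a ≠ d) (hbd : b ≠ d) (hcd : c ≠ d)
    (ψ : MvPolynomial (Fin n) k →ₐ[k] MvPolynomial (Fin n) k) (hψinj : Function.Injective ψ)
    (hψa : ψ (X a) = X b ^ 3 * X a) (hψH : ψ Hp = X b ^ 4 * Qp) (hψT : ψ Tp = X b ^ 6 * Qp)
    (hψM : ψ Mp = X c * X b ^ 3 * Qp)
    (q : Fin 8 → MvPolynomial (Fin n) k) (hq : ∀ j, ψ (g j) = X b ^ 6 * q j)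
    (hqE : ∀ j, q j ∈ Algebra.adjoin k Egens) (hψE : ∀ i, ψ (X i) ∈ Algebra.adjoin k Egens)
    (hψfix : ∀ i, i ≠ a → i ≠ b → i ≠ c → i ≠ d → ψ (X i) = X i)
    (C : Type) [CommRing C] [Algebra BT C] [IsLocalization.Away θT C] :
    ∃ e : C ≃+* EQ,
      (∀ F : MvPolynomial (Fin n) k,
        ((e ((algebraMap BT C : BT →+* C) (φT F)) : EQ) : LQ) = algebraMap (MvPolynomial (Fin n) k) LQ (ψ F)) ∧
      (∀ j : Fin 8,
        ((e ((algebraMap BT C : BT →+* C) (HomogeneousLocalization.Away.mk (reesGrading I6) (reesT_mem Tp hT) 1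
          (reesT (g j) (Ideal.mem_span_range_self (f := g) (x := j))) (reesT_mem_one_smul g j))) :
            EQ) : LQ) =
          algebraMap (MvPolynomial (Fin n) k) LQ (q j) * IsLocalization.Away.invSelf Qp) ∧
      ((e ((algebraMap BT C : BT →+* C) (θT : BT)) : EQ) : LQ) = algebraMap (MvPolynomial (Fin n) k) LQ Qp := by
  have hXb : (X b : MvPolynomial (Fin n) k) ≠ 0 := X_ne_zero b
  have hXa : (X a : MvPolynomial (Fin n) k) ≠ 0 := X_ne_zero a
  -- `ψ(H'³) = Q (s⁶Q)²`
  have hψH3 : ψ (Hp ^ 3) = Qp * (X b ^ 6 * Qp) ^ 2 := by rw [map_pow, hψH]; ring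
  -- `ψ Δ₇ = η (s⁶Q)² Q`
  obtain ⟨Δ, hΔ, hΔrel⟩ := exists_Delta7_mem_span_sq k n a b c d g hg0 hg1 hg2 hg3 hg4 hg5 hg6
  have hψΔ : ψ Δ * Qp ^ 0 = X d * (X b ^ 6 * Qp) ^ 2 * Qp ^ 1 := by
    have hgen : ∀ T H A D : MvPolynomial (Fin n) k, ψ T = X b ^ 6 * Qp → ψ H = X b ^ 4 * Qp →
        ψ A = X b ^ 3 * X a → A ^ 2 * D = T * H ^ 3 - T ^ 3 + 3 * A * T ^ 2 * H →
        (X b ^ 3 * X a) ^ 2 * (ψ D * Qp ^ 0) =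
          (X b ^ 3 * X a) ^ 2 * (X d * (X b ^ 6 * Qp) ^ 2 * Qp ^ 1) := by
      intro T H A D hT' hH' hA' hrel
      have h1 := congrArg ψ hrel
      simp only [map_add, map_sub, map_mul, map_pow, hT', hH', hA', map_ofNat] at h1
      linear_combination h1
    exact mul_left_cancel₀ (pow_ne_zero 2 (mul_ne_zero (pow_ne_zero 3 hXb) hXa))
      (hgen _ _ _ _ hψT hψH hψa hΔrel)
  have h1 : ∀ {F : MvPolynomial (Fin n) k}, F ∈ I6 → F ∈ I6 ^ 1 := fun hF => by rwa [pow_one]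
  refine exists_ringEquiv_of_twistData k n a b c d g Tp hT (Hp ^ 3) hH3 had hbd hcd ψ hψinj hψT hψH3
    q hq hqE hψE hψfix ?_ C
  -- the inverse dictionary
  intro t ht
  rcases ht with rfl | rfl | rfl | rfl | rfl | rfl | rfl
  · exact ⟨1, 1, 0, _, h1 (Hsq_mem_span k n a b c g hg0 hg1 hg2 hg3 hg4 hg5 hg6 hg7), by rw [map_pow, hψH]; ring⟩
  · exact ⟨1, 0, 0, _, h1 (xaH_mem_span k n a b c g hg0 hg1 hg2 hg3 hg4 hg5 hg6 hg7), by rw [map_mul, hψa, hψH]; ring⟩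
  · exact ⟨1, 1, 0, _, h1 (MH_mem_span k n a b c d g hg0 hg1 hg2 hg3 hg4 hg5 hg6 hg7), by rw [map_mul, hψM, hψH]; ring⟩
  · exact ⟨1, 0, 1, X a ^ 2, h1 (Xa_sq_mem_span k n a g hg0), by rw [map_pow, hψa]; ring⟩
  · exact ⟨1, 0, 0, _, h1 (xaM_mem_span k n a b c d g hg0 hg1 hg2 hg3 hg4 hg5 hg6 hg7), by rw [map_mul, hψa, hψM]; ring⟩
  · exact ⟨1, 1, 0, _, h1 (Msq_mem_span k n a b c d g hg0 hg1 hg2 hg3 hg4 hg5 hg6 hg7), by rw [map_pow, hψM]; ring⟩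
  · exact ⟨2, 1, 0, Δ, hΔ, hψΔ⟩

end ChartT

end Summit.ResolutionOfSingularities.ResolutionOfSingularities.Theorems.WildQuotientResolution.JordanFour

end
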